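import Summits.QuantumFields.BalabanUV.Beta.FP.FineSplitJunctionNearFar
import Summits.QuantumFields.BalabanUV.Beta.D1BFx.PackedKernelSplit

/-!
# `BalabanUV.Beta.FP.FineSplitJunctionLedger` — road «FP» for binder row D1, row KER-γ «THE JUNCTION», SOCKET (α0), the LEDGER-SIDE PLUG (E)
# (owner GO R-FP-35 (d)): THE NEAR NUMBER OF `FineSplitJunctionNearFar` FROM A FINITE FAMILY OF NEAR PIECES — if the near piece
# `(F m − (Lc^m)⁸·PiBF(s′−s))·𝟙[‖s′−s‖∞ ≤ Lc^m]` is, entrywise, the sum `Σ_{j∈J} G j m` of BOUNDED two-point pieces whose induced coarse pieces are (rem)-bounded by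
# m-free `B j`, then `hnear` holds with `B_near := Σ_{j∈J} B j`; hence (ASYMP) at the bi-vertex perfect kernel ⟸ H2V-4 letters ∧ colour equation ∧ far letter ∧ a
# FINITE NEAR LEDGER `{(G j, B j)}_{j∈J}` — the owner's (LEDGER) row reduced to choosing `J` and citing the `B j`; + the generic `blockTerms_of_ffOnly` (α2-b's first lemma)

HONEST DEPENDENCY (page 1, mandatory): continuum YM on T⁴ ⇐ BetaPertH ∧ nine spine estimates (0/9 proved); BetaPertH ⇐ (D1) ∧ (D4) ∧
CAP+tail; G-an2-4 gates asym, D1 and NE2/3/4.  HONEST FRAMING (cell contract, verbatim): «discharging `BetaPertH` makes Bałaban's UV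
stability UNCONDITIONAL — a real constructive-QFT result; it is NOT the continuum limit and NOT the Clay problem.»  THIS MODULE is [folklore] bookkeeping +
a by-name composition: `FineSplitJunction.dressedEntryP_split` (at `P := 0`), `RemainderLedger.rem_sum`, `FineSplitJunctionNearFar.hasym_PiBF_vertex2OfK_of_near_far`;
and, for α2-b (owner), the generic vanishing of `PackedKernelSplit.blockTerms` for a packed leg with ZERO fm∕mf∕mm blocks (`KernelWardRelative.comp_zero_left`∕`tr_zero`,
`StepDriftWitness.comp_zero_right`).  No `def`, no `def … : Prop`, nothing cited, nothing of the manuscripts under audit asserted, 0 sorry.  NOT any (rem) engine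
instance, NOT the choice of `J`, NOT the far letter; hence NOT (ASYMP) for the literal, NOT D1; 0∕4 row-D1 binders; NOT BetaPertH, NOT continuum, NOT Clay.

ABSOLUTE RULE (cell charter, verbatim): «No internally-minted statement may enter as a cited fact. Every hypothesis is either kernel-proved in this
package or a verbatim quotation of a PUBLISHED theorem with page reference. The manuscript(s) under audit are NOT citable for their own disputed
steps — they are the thing under adjudication; programme-internal (2001/route/tribunal) claims are never citable.»

CONTENT: §1 [folklore] `tadpole_zero_left`, `biBubble_zero_left`, `biBubble_zero_third`, **`blockTerms_of_ffOnly`** (`blk A true false = 0`, `blk A false true = 0`,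
`blk A false false = 0` ⟹ `blockTerms A V W μ ν z = 0` for all `V`, `W`); §2 [folklore] `dressedEntryP_zero`, **`dressedEntryP_finset_sum`** (the sandwich of a finite sum of
BOUNDED two-point tables, absolutely summable patterns), **`rem_dressedEntryP_sum`** (the (rem) letter of the induced piece of `Σ_j G j` is `≤ Σ_j B j`);
§3 [our object] **`hasym_PiBF_vertex2OfK_of_far_nearPieces`** — `FineSplitJunctionNearFar.hasym_PiBF_vertex2OfK_of_near_far` with `hnear` REPLACED by a finite near ledger.
Provenance: D1 formalisation swarm LEAF PROVER 01, unit `b2b-balaban-beta-d1-formalise-leaf-01` gen 11, 2026-08-21, road FP row KER-γ (α0) ∕ (LEDGER) plug (E); «not in print; our bookkeeping».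
-/

noncomputable section

namespace Summit.QuantumFields.BalabanUV.Beta.FP.FineSplitJunctionLedger

open Finset
open scoped BigOperators
open Literature.MathematicalPhysics.QuantumFieldTheory.Balaban1983to89
open Literature.MathematicalPhysics.QuantumFieldTheory.Balaban1983to89.Beta
open Literature.MathematicalPhysics.QuantumFieldTheory.Balaban1983to89.Beta.BubbleTransfer (c4)
open Literature.MathematicalPhysics.QuantumFieldTheory.Balaban1983to89.B12Normalization (stepBal)
open B12Sec2to5 (l1)
open PolarizationSign (reflSign)
open ExpKernelCalculus (Site MKer BiLoc comp shiftK tr tadpole bubble)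
open OneStepResolventKernel (Fib LocStencil)
open OneStepKernelFamily (colH)
open KernelWard (divV divW)
open KernelReflection (LegMap refK bondRefl)
open DyadicShell (Pt supNorm)
open LeadingCoefficient (kappaBal)
open AxialProjector (coProj)
open AxialDressing (axDressK)
open SecondOrderResponse (vertex2OfK)
open StepDriftWitness (comp_zero_right)
open Summit.QuantumFields.BalabanUV.Beta.KernelWardRelative (comp_zero_left tr_zero)
open Summit.QuantumFields.BalabanUV.Beta.GAN24.CombesThomas (sfStep smStep)
open Summit.QuantumFields.BalabanUV.Beta.D1BFx.MomentTransferPeriodicSum (dressedSumP)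
open Summit.QuantumFields.BalabanUV.Beta.D1BFx.MomentTransferPeriodicEntry (EKer₂ dressedEntryP)
open Summit.QuantumFields.BalabanUV.Beta.D1BFx.ReducedKernelSandwichLeg (fineHessA)
open Summit.QuantumFields.BalabanUV.Beta.D1BFx.PackedKernelSplit (blk biBubble blockTerms)
open Summit.QuantumFields.BalabanUV.Beta.FP.PerfectObjectsT (KPerf TPerfOf)
open Summit.QuantumFields.BalabanUV.Beta.FP.WilsonCubicGerm (cubicGermOf)
open Summit.QuantumFields.BalabanUV.Beta.FP.GhostCubicGerm (cubicGermOfSc)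
open Summit.QuantumFields.BalabanUV.Beta.FP.BubbleGermValue (bfGerm ghostGerm)
open Summit.QuantumFields.BalabanUV.Beta.FP.PerfectPolarization (Pker G0ker PiBF)
open Summit.QuantumFields.BalabanUV.Beta.FP.RemainderLedger (rem_sum)
open Summit.QuantumFields.BalabanUV.Beta.FP.FineSplitJunction (dressedEntryP_split)
open Summit.QuantumFields.BalabanUV.Beta.FP.FineSplitJunctionNearFar (hasym_PiBF_vertex2OfK_of_near_far)

/-! ## §1 The block terms of an ff-only packed leg vanish (for α2-b) -/

section FFOnly

variable {D : ℕ} {F : Type*} [Fintype F]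

/-- [folklore] A tadpole with the zero leg vanishes. -/
theorem tadpole_zero_left (W : MKer D F) : tadpole (0 : MKer D F) W = 0 := by
  simp only [ExpKernelCalculus.tadpole, comp_zero_left, tr_zero]

/-- [folklore] A bi-bubble with the zero FIRST leg vanishes. -/
theorem biBubble_zero_left (V B W : MKer D F) : biBubble (0 : MKer D F) V B W = 0 := by
  simp only [biBubble, comp_zero_left, tr_zero]

/-- [folklore] A bi-bubble with the zero THIRD leg vanishes. -/
theorem biBubble_zero_third (A V W : MKer D F) : biBubble A V (0 : MKer D F) W = 0 := by
  simp only [biBubble, comp_zero_left, comp_zero_right, tr_zero]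

/-- [folklore] **THE BLOCK TERMS OF AN ff-ONLY PACKED LEG VANISH**: if the fm, mf and mm blocks of the packed leg `A` are zero, then for ALL packed vertex
families `V`, `W`: `blockTerms A V W μ ν z = 0` — every one of the 3 + 15 words carries a non-ff block of `A` as its first or third leg.  (α2-b's first lemma:
for the right member of `hfine`, `PiBF`'s gluon leg `Pker` has no multiplier blocks, `PerfectPolarization.Pker_inl_inr`∕`_inr_inl`∕`_inr_inr`.) -/
theorem blockTerms_of_ffOnly {A : MKer D (F ⊕ F)} (hfm : blk A true false = 0) (hmf : blk A false true = 0) (hmm : blk A false false = 0)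
    (V : Fin D → Site D → MKer D (F ⊕ F)) (W : Fin D → Site D → Fin D → Site D → MKer D (F ⊕ F)) (μ ν : Fin D) (z : Site D) :
    blockTerms A V W μ ν z = 0 := by
  simp only [blockTerms, Fintype.sum_bool, Bool.true_and, Bool.false_and, cond_true, cond_false, hfm, hmf, hmm,
    tadpole_zero_left, biBubble_zero_left, biBubble_zero_third]
  ring

end FFOnly

/-! ## §2 The sandwich of a finite sum of pieces; the (rem) letter adds up -/

section Sum

variable {D : ℕ}

/-- [folklore] The sandwich of the zero table vanishes. -/
theorem dressedEntryP_zero (w : DressedMomentNormalisation.EKer D) (y : Site D) (a b : Fin D) :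
    dressedEntryP w (fun _ _ _ _ => (0 : ℝ)) y a b = 0 := by
  unfold dressedEntryP dressedSumP
  simp only [mul_zero, zero_mul, tsum_zero, Finset.sum_const_zero]

/-- [folklore] **THE SANDWICH OF A FINITE SUM OF BOUNDED PIECES** (absolutely summable patterns): if `F = Σ_{j∈J} G j` entrywise and every `G j` is bounded,
`dressedEntryP w F y a b = Σ_{j∈J} dressedEntryP w (G j) y a b`. -/
theorem dressedEntryP_finset_sum {ι : Type*} (J : Finset ι) {w : DressedMomentNormalisation.EKer D} {F : EKer₂ D} {G : ι → EKer₂ D}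
    (hw : ∀ κ l, Summable fun u => |w κ l u|) (hF : ∀ c e s s', F c e s s' = ∑ j ∈ J, G j c e s s')
    (hGb : ∀ j ∈ J, ∀ c e, ∃ A, ∀ s s', |G j c e s s'| ≤ A) (y : Site D) (a b : Fin D) :
    dressedEntryP w F y a b = ∑ j ∈ J, dressedEntryP w (G j) y a b := by
  have h := dressedEntryP_split J (F := F) (P := fun _ _ _ _ => (0 : ℝ)) (G := G) hw (fun c e s s' => by rw [sub_zero]; exact hF c e s s')
    (fun c e => ⟨0, fun s s' => by rw [abs_zero]⟩) hGb y a b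
  rwa [dressedEntryP_zero, sub_zero] at h

/-- [folklore] **THE (rem) LETTER OF THE INDUCED PIECE OF A FINITE SUM** is bounded by the sum of the pieces' letters: columns `w m` with absolutely summable
entries, `F m = Σ_{j∈J} G j m` entrywise with bounded `G j m`, each induced piece `u ↦ dressedEntryP (w m) (G j m) (N m•(−u)) a b` (rem)-bounded by `B j` (m-free)
⟹ `∀ S, Σ_{u∈S} ‖u‖∞²·|dressedEntryP (w m) (F m) (N m•(−u)) a b| ≤ Σ_{j∈J} B j`. -/
theorem rem_dressedEntryP_sum {ι : Type*} (J : Finset ι) {w : ℕ → DressedMomentNormalisation.EKer 4} {Nb : ℕ → ℕ} {F : ℕ → EKer₂ 4}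
    {G : ι → ℕ → EKer₂ 4} {B : ι → ℝ} {a b : Fin 4} {m : ℕ}
    (hw : ∀ κ l, Summable fun u => |w m κ l u|) (hF : ∀ c e s s', F m c e s s' = ∑ j ∈ J, G j m c e s s')
    (hGb : ∀ j ∈ J, ∀ c e, ∃ A, ∀ s s', |G j m c e s s'| ≤ A)
    (hB : ∀ j ∈ J, ∀ S : Finset Pt, ∑ u ∈ S, (supNorm u : ℝ) ^ 2 * |dressedEntryP (w m) (G j m) (((Nb m : ℕ) : ℤ) • (-u)) a b| ≤ B j) :
    ∀ S : Finset Pt, ∑ u ∈ S, (supNorm u : ℝ) ^ 2 * |dressedEntryP (w m) (F m) (((Nb m : ℕ) : ℤ) • (-u)) a b| ≤ ∑ j ∈ J, B j := by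
  intro S
  have h := rem_sum J (D := fun j u => dressedEntryP (w m) (G j m) (((Nb m : ℕ) : ℤ) • (-u)) a b) hB S
  refine le_of_eq_of_le (Finset.sum_congr rfl fun u _ => ?_) h
  rw [dressedEntryP_finset_sum J hw hF hGb]

end Sum

/-! ## §3 (ASYMP) at the bi-vertex perfect kernel from the far letter and a FINITE near ledger -/

section Ledger

variable {Lc : ℕ} [NeZero Lc]

/-- **(ASYMP) FOR THE BI-VERTEX PERFECT ONE-LOOP KERNEL ⟸ H2V-4 LETTERS ∧ COLOUR EQUATION ∧ FAR LETTER ∧ A FINITE NEAR LEDGER** [our object]: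
`FineSplitJunctionNearFar.hasym_PiBF_vertex2OfK_of_near_far` with the near number REPLACED by a finite family of near pieces: `hnearSplit` (the near piece of `F m`
against `(Lc^m)⁸·PiBF(s′−s)` is `Σ_{j∈J} G j m` entrywise on ALL of `Pt × Pt` — the pieces vanish outside the window or absorb it), `hGb` (bounded pieces), `hledger`
(each induced coarse piece (rem)-bounded by an m-free `B j`).  Conclusion: `∃ U ≥ 0, ∃ Cg, ∀ m ≥ 1, |secondMoment (T m) μ ν − m·stepBal N Lc| ≤ (U + Σ_{j∈J} B j) + Cg`.
The owner's (LEDGER) row = the choice of `J`, `G j` ((G1)–(G5),(G7) of `KER-GAMMA-ALPHA2.md` §3) and the citation of each `B j` from its landed engine. -/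
theorem hasym_PiBF_vertex2OfK_of_far_nearPieces (hLc : 2 ≤ Lc) (wg wgh : ℝ)
    {V : Fin 4 → Site 4 → MKer 4 (Fib 3)} {W : Fin 4 → Site 4 → Fin 4 → Site 4 → MKer 4 (Fib 3)}
    {v : Fin 4 → Site 4 → MKer 4 Unit} {w : Fin 4 → Site 4 → Fin 4 → Site 4 → MKer 4 Unit} {Cv Cw Cx Cw' Cx' CwL CwL' cQ δ : ℝ} (hδ : 0 < δ)
    -- admissible-family letters, gluon sector
    (hV : ∀ (μ : Fin 4) (y : Site 4), BiLoc (V μ y) y y Cv δ) (hW : ∀ (μ : Fin 4) (y : Site 4) (ν : Fin 4) (y' : Site 4), BiLoc (W μ y ν y') y y' Cw δ)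
    (hcovV : ∀ (μ : Fin 4) (y t : Site 4), V μ (y + t) = shiftK (-t) (V μ y))
    (hcovW : ∀ (μ : Fin 4) (y : Site 4) (ν : Fin 4) (y' t : Site 4), W μ (y + t) ν (y' + t) = shiftK (-t) (W μ y ν y'))
    (X : Site 4 → MKer 4 (Fib 3)) (hX : ∀ y, BiLoc (X y) y y Cx δ)
    (hW1 : ∀ y, comp (comp Pker (divV V y)) Pker = comp Pker (X y) - comp (X y) Pker)
    (hW2 : ∀ y ν y', divW W y ν y' = comp (X y) (V ν y') - comp (V ν y') (X y))
    (hreflP : ∀ α : Fin 4, ∃ Φα : LegMap 4 (Fib 3), refK Φα Pker = Pker ∧ ∃ c : ℤ,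
      (∀ μ y, V μ (bondRefl α c μ y) = reflSign α μ • refK Φα (V μ y)) ∧
      (∀ μ y ν y', W μ (bondRefl α c μ y) ν (bondRefl α c ν y') = (reflSign α μ * reflSign α ν) • refK Φα (W μ y ν y')))
    (h0V : ∀ (lam α β : Fin 4), ∑' p : Pt × Pt, V lam 0 p.1 p.2 (Sum.inl α) (Sum.inl β) = 0)
    (hgermV : cubicGermOf V = cQ • bfGerm)
    (hWloc : ∀ (μ ν : Fin 4) (z : Pt), BiLoc (W μ 0 ν z) 0 z (CwL * Real.exp (-δ * l1 z)) δ)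
    -- admissible-family letters, ghost sector
    (hv : ∀ (μ : Fin 4) (y : Site 4), BiLoc (v μ y) y y Cv δ) (hw : ∀ (μ : Fin 4) (y : Site 4) (ν : Fin 4) (y' : Site 4), BiLoc (w μ y ν y') y y' Cw' δ)
    (hcovv : ∀ (μ : Fin 4) (y t : Site 4), v μ (y + t) = shiftK (-t) (v μ y))
    (hcovw : ∀ (μ : Fin 4) (y : Site 4) (ν : Fin 4) (y' t : Site 4), w μ (y + t) ν (y' + t) = shiftK (-t) (w μ y ν y'))
    (Xg : Site 4 → MKer 4 Unit) (hXg : ∀ y, BiLoc (Xg y) y y Cx' δ)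
    (hW1g : ∀ y, comp (comp G0ker (divV v y)) G0ker = comp G0ker (Xg y) - comp (Xg y) G0ker)
    (hW2g : ∀ y ν y', divW w y ν y' = comp (Xg y) (v ν y') - comp (v ν y') (Xg y))
    (hreflG : ∀ α : Fin 4, ∃ Ψα : LegMap 4 Unit, refK Ψα G0ker = G0ker ∧ ∃ c : ℤ,
      (∀ μ y, v μ (bondRefl α c μ y) = reflSign α μ • refK Ψα (v μ y)) ∧
      (∀ μ y ν y', w μ (bondRefl α c μ y) ν (bondRefl α c ν y') = (reflSign α μ * reflSign α ν) • refK Ψα (w μ y ν y')))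
    (h0v : ∀ lam : Fin 4, ∑' p : Pt × Pt, v lam 0 p.1 p.2 () () = 0)
    (hgermv : cubicGermOfSc v = ghostGerm)
    (hwloc : ∀ (μ ν : Fin 4) (z : Pt), BiLoc (w μ 0 ν z) 0 z (CwL' * Real.exp (-δ * l1 z)) δ)
    -- the colour weights and the entry
    {N : ℝ} (hn : (40 * wg * (1 / 4 : ℝ) * (c4 * cQ) ^ 2 - wgh * (-(1 / 2 : ℝ)) * c4 ^ 2) / 3 = kappaBal N)
    {μ ν : Fin 4} (hμν : μ ≠ ν)
    -- the road's first-order stencils and bi-tables at every `m` (letters per `m`, constants free)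
    {S : ℕ → Fin (3 + 1) → (Fin (3 + 1) → ℤ) → MKer (3 + 1) (Fib 3)}
    (hS : ∀ m : ℕ, 1 ≤ m → ∃ Cs δs : ℝ, 0 < δs ∧ LocStencil (S m) Cs δs ∧
      ∀ κ u t, S m κ (u + ((Lc ^ m : ℕ) : ℤ) • t) = shiftK (-(((Lc ^ m : ℕ) : ℤ) • t)) (S m κ u))
    {Wf : ℕ → Fin (3 + 1) → (Fin (3 + 1) → ℤ) → Fin (3 + 1) → (Fin (3 + 1) → ℤ) → MKer (3 + 1) (Fib 3)}
    (hWf : ∀ m : ℕ, 1 ≤ m → ∃ C2 δ2 : ℝ, 0 < δ2 ∧ (∀ κ' u l' u', BiLoc (Wf m κ' u l' u') u u' C2 δ2) ∧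
      ∀ κ' u l' u' t, Wf m κ' (u + ((Lc ^ m : ℕ) : ℤ) • t) l' (u' + ((Lc ^ m : ℕ) : ℤ) • t)
        = shiftK (-(((Lc ^ m : ℕ) : ℤ) • t)) (Wf m κ' u l' u'))
    -- the FAR LETTER of the full fine kernel (m-free shape) and the NEAR LEDGER (one number)
    {CF a : ℝ} (hCF : 0 ≤ CF) (ha : 0 < a)
    (hfar : ∀ m : ℕ, 1 ≤ m → ∀ (c e : Fin 4) (s s' : Pt), Lc ^ m < supNorm (s' - s) →
      |fineHessA (axDressK (Lc ^ m) (KPerf (d := 3) Lc (sfStep Lc) (smStep 3 Lc) m)) (coProj (Lc ^ m) (S m)) (Wf m) c e s s'|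
        ≤ ((Lc ^ m : ℕ) : ℝ) ^ 8 * (CF / (supNorm (s' - s) : ℝ) ^ 6 * Real.exp (-(a / ((Lc ^ m : ℕ) : ℝ)) * (supNorm (s' - s) : ℝ))))
    -- the FINITE NEAR LEDGER
    {ι : Type*} (J : Finset ι) {G : ι → ℕ → EKer₂ 4} {B : ι → ℝ}
    (hnearSplit : ∀ m : ℕ, 1 ≤ m → ∀ (c e : Fin 4) (s s' : Pt),
      (if supNorm (s' - s) ≤ Lc ^ m then
          fineHessA (axDressK (Lc ^ m) (KPerf (d := 3) Lc (sfStep Lc) (smStep 3 Lc) m)) (coProj (Lc ^ m) (S m)) (Wf m) c e s s'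
            - ((Lc ^ m : ℕ) : ℝ) ^ 8 * PiBF wg wgh V W v w c e (s' - s) else 0) = ∑ j ∈ J, G j m c e s s')
    (hGb : ∀ j ∈ J, ∀ m : ℕ, 1 ≤ m → ∀ c e : Fin 4, ∃ A, ∀ s s', |G j m c e s s'| ≤ A)
    (hledger : ∀ j ∈ J, ∀ m : ℕ, 1 ≤ m → ∀ S' : Finset Pt, ∑ u ∈ S', (supNorm u : ℝ) ^ 2 *
      |dressedEntryP (fun c a' => colH (KPerf (d := 3) Lc (sfStep Lc) (smStep 3 Lc) m) (Lc ^ m) a' 0 c) (G j m)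
        (((Lc ^ m : ℕ) : ℤ) • (-u)) μ ν| ≤ B j) :
    ∃ U : ℝ, 0 ≤ U ∧ ∃ Cg : ℝ, ∀ m : ℕ, 1 ≤ m →
      |B12Beta.secondMoment (TPerfOf (Lc ^ m) (KPerf (d := 3) Lc (sfStep Lc) (smStep 3 Lc) m) (S m)
          (vertex2OfK (KPerf (d := 3) Lc (sfStep Lc) (smStep 3 Lc) m) (Lc ^ m) (Wf m))) μ ν - (m : ℝ) * stepBal N Lc|
        ≤ (U + ∑ j ∈ J, B j) + Cg := by
  -- the column letter at the perfect resolvent (absolute summability of the END columns)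
  have hcol : ∀ m, 1 ≤ m → ∀ κ l : Fin 4, Summable fun u => |TransportInfinityM.colOf (KPerf (d := 3) Lc (sfStep Lc) (smStep 3 Lc) m) κ l u| :=
    fun m hm κ l => (DecimatedMomentSummable.summable_of_absMoment₂ ((PerfectBubbleSandwich.entryHyps_perfCol_zero hLc hm).absW κ l)).abs
  have hcolH : ∀ m, 1 ≤ m → ∀ κ l : Fin 4,
      Summable fun u => |(fun c a' => colH (KPerf (d := 3) Lc (sfStep Lc) (smStep 3 Lc) m) (Lc ^ m) a' 0 c) κ l u| :=
    fun m hm κ l => FineSplitJunction.summable_abs_colH_of_colOf (hcol m hm) (Lc ^ m) κ l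
  -- the near number is the sum of the ledger
  have hnear : ∀ m : ℕ, 1 ≤ m → ∀ S' : Finset Pt, ∑ u ∈ S', (supNorm u : ℝ) ^ 2 *
      |dressedEntryP (fun c a' => colH (KPerf (d := 3) Lc (sfStep Lc) (smStep 3 Lc) m) (Lc ^ m) a' 0 c)
        (fun c e s s' => if supNorm (s' - s) ≤ Lc ^ m then
          fineHessA (axDressK (Lc ^ m) (KPerf (d := 3) Lc (sfStep Lc) (smStep 3 Lc) m)) (coProj (Lc ^ m) (S m)) (Wf m) c e s s'
            - ((Lc ^ m : ℕ) : ℝ) ^ 8 * PiBF wg wgh V W v w c e (s' - s) else 0)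
        (((Lc ^ m : ℕ) : ℤ) • (-u)) μ ν| ≤ ∑ j ∈ J, B j := fun m hm =>
    rem_dressedEntryP_sum J (w := fun m => fun c a' => colH (KPerf (d := 3) Lc (sfStep Lc) (smStep 3 Lc) m) (Lc ^ m) a' 0 c)
      (Nb := fun m => Lc ^ m) (m := m)
      (F := fun m c e s s' => if supNorm (s' - s) ≤ Lc ^ m then
          fineHessA (axDressK (Lc ^ m) (KPerf (d := 3) Lc (sfStep Lc) (smStep 3 Lc) m)) (coProj (Lc ^ m) (S m)) (Wf m) c e s s'
            - ((Lc ^ m : ℕ) : ℝ) ^ 8 * PiBF wg wgh V W v w c e (s' - s) else 0)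
      (hcolH m hm) (hnearSplit m hm) (fun j hj c e => hGb j hj m hm c e) (fun j hj S' => hledger j hj m hm S')
  exact hasym_PiBF_vertex2OfK_of_near_far hLc wg wgh hδ hV hW hcovV hcovW X hX hW1 hW2 hreflP h0V hgermV hWloc hv hw hcovv hcovw Xg hXg hW1g hW2g
    hreflG h0v hgermv hwloc hn hμν hS hWf hCF ha hfar hnear

end Ledger

end Summit.QuantumFields.BalabanUV.Beta.FP.FineSplitJunctionLedger

end
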